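import Mathlib
import HarnessLib
import Summits.HubbardSuperconductivity.HubbardSuperconductivity.Theorems.KLProgrammeKLRegimeEngineV8DefsG6Q6
import Summits.HubbardSuperconductivity.HubbardSuperconductivity.Theorems.KLProgrammeKLRegimeTwoLegCurvatureDefs

/-!
# K3 ENGINE / engine-flow child — C4a's NATURAL CONSTANT TABLES for the curve-jet stub: `klC4aJetC k` (absolute, leading second order)
# and `klC4aJetC' P R k` (the `|U|`-suppressed remainder, orders ≥ 3), `k ≤ 4`, with the two PACKAGE INEQUALITIES against (klS6, klS6′)

Cell `gate-hubbard-kl`, lane hubbard-kl-c4a-1 (C4a inductive tangential bound); plan g16 (R25)(c)(i) / K3-FLOW RULING F (5)(S4)(a): «inputs (i) c4a-1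
consts … STILL WANTED, unchanged names/arities».  Stub 6 of the engine child reads `TwoLegCurveJetBound L M klC4aJetC (klC4aJetC' P R) β U μ K n`
(…TwoLegCurvatureDefs, p2; its flow twin `TwoLegReadJetsF` at the tame frame `K_n`): `|∂_θᵏ δ_n| ≤ curveJetBar klC4aJetC (klC4aJetC' P R) U k n =
(klC4aJetC k + klC4aJetC' P R k·|U|)·uPow k U·4^{(k−2)n}`.  The consumers' divided fit (r2d-p1, …TwoLegCurvatureJetX / …EngineTwoLegStepSuccDoorPkg §4)
needs the package inequalities `klJetX k·klC4aJetC k ≤ klS6 k` and `klJetX k·klC4aJetC′ P R k ≤ klS6′ P R k` (k3c2-p2's …EngineV8DefsG6Q6, sufficiency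
pointers `klJetX_mul_le_klS6` / `klJetX_mul_le_klS6'`: any table `≤ 2^26`, resp. `≤ 2^26·(klEngQ5 P R).S′ k`).  THE TABLES ARE GENEROUS POWERS OF TWO
ABOVE THE NATURAL SIZES (free upward: a table later found too small is raised by a one-line successor package):

| k | law (`uPow k U·4^{(k−2)n}`) | natural size (derivation pointer) | `klC4aJetC k` |
|---|---|---|---|
| 0 | `|U|·16^{−n}` | VALUE of the scale-`n` piece on the curve: of record from the (ρ1)/(ρ2) tier-1 lanes (engine packages V8: `S 0 = 2^10`); not re-derived here | `2^10` |
| 1 | `U²·4^{−n}` | SLOPE: of record, tier-1 (`S 1 = 2^10`) | `2^10` |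
| 2 | `U²` (no gain) | CURVATURE — C4a-reg proper: per-scale corner increment `2B_nα_n²·ln 4·s′(θ*)²·U²` in `θ`-derivatives (DECOMP App. C; P2-C4B §3: `2Bα² = 1.886e-3 / 2.060e-3 / 1.307e-3` per `U²` per `ln(1/T)` at `δ = 0.10/0.20/0.35`, kit j247717 ratio 1.000; `s′² ≲ 6`) `≲ 0.05`, plus the generic-angle remainder, which DECAYS (C4A-PLAN §2c/§3b, kit j275159/j275370: `≲ 3e-3` at the top scales, halving per octave) | `1` |
| 3 | `U²·4ⁿ` | corner bump third derivative: height `≲ 0.05·U²`, angular half-width `≈ 4Λ_n/(v(p₁)|α|s′) ≈ 0.026·4^{−n}` (`Λ_n = klE0·4^{−n}`, `klE0 = 1/32`; P2-C4B §3 `σ½ = 4.0·T/(v|α|)`), shape factor `≲ 1.5` ⇒ `≲ 3·4ⁿ·U²` — SHARP at the 8 corners (C4A-PLAN §4) | `2^4` |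
| 4 | `U²·16ⁿ` | corner bump fourth derivative: `≲ 0.05·3/0.026²·16ⁿ ≈ 220·16ⁿ·U²`, sharp | `2^11` |

`klC4aJetC′ P R k := 2^20·(klEngQ5 P R).S′ k` for every `k` — the `|U|`-suppressed remainder (orders ≥ 3 in `U`: the third-order corner coefficients are
`c₃^{pp} ≈ −0.45`, `c₃^{ph} ≈ +0.54` in units of `2Bα²` per `U` (C4A-PLAN §3b, kit j275159/j275370: net `B → B(1 + 0.09U)`), i.e. natural `c′₂ ≈ 0.03`
in `θ`-units; the table sits astronomically above, inside the sufficiency window `≤ 2^26·S′`).  Orders `k ≥ 5` are never read (the predicate stops at 4);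
the tables are extended by their `k = 4` row.

* §1 the tables + evaluation lemmas + nonnegativity + `klC4aJetC_le_two_pow` (`≤ 2^26`), `klC4aJetC'_le`;
* §2 the PACKAGE INEQUALITIES `klJetX_mul_klC4aJetC_le_klS6`, `klJetX_mul_klC4aJetC'_le_klS6'`, and the divided forms
  `klC4aJetC_le_klEngGeo6_S_div`, `klC4aJetC'_le_klEngQ6_S'_div` (what r2d-p1's (e)-door `twoLegStepV16_succ_of_jets2Nat_pkg` asks BY NAME);
* §3 `curveJetBar_klC4aJetC_le_twoLegBar_klEng6` — the bar at these tables is below the package's own `twoLegBar klEngGeo6 (klEngQ6 P R)`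
  (so `TwoLegCurveJetBound … klC4aJetC (klC4aJetC' P R)` implies the `(G6,Q6)` instance `TwoLegCurveJetBoundGQ`, `TwoLegCurveJetBound.mono`).

Definitions of real constants + arithmetic; nothing is asserted about the Hubbard model.  References: BGM 2006 §2.4 (2.36)/(2.42)
[cite: BenfattoGiulianiMastropietro2006]; HOME/hubbard-kl-c4a-1/C4A-PLAN.md §2b/§3b/§4; HOME/P2-C4B.md §3.
-/

noncomputable section

namespace Summit.HubbardSuperconductivity.HubbardSuperconductivity.Theorems.KLRegimeSplit

set_option linter.dupNamespace false -- summit = problem name (single-conjunct summit), D-0017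

open Real Literature.MathematicalPhysics.QuantumLattice Literature.Probability.LatticeModels
open Summit.HubbardSuperconductivity.HubbardSuperconductivity.Theorems.EngineV8

/-! ## §1 The tables -/

/-- **`klC4aJetC k`** — C4a's ABSOLUTE curve-jet table (leading, second order; generous powers of two above the natural sizes, see the module table):
`2^10` (k = 0, 1: tier-1 values of record), `1` (k = 2: curvature, the App. C corner log spent per scale), `2^4` (k = 3), `2^11` (k ≥ 4). -/
def klC4aJetC (k : ℕ) : ℝ :=
  if k ≤ 1 then 2 ^ 10 else if k = 2 then 1 else if k = 3 then 2 ^ 4 else 2 ^ 11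

/-- **`klC4aJetC' P R k := 2^20·(klEngQ5 P R).S′ k`** — the `|U|`-suppressed remainder table (orders ≥ 3 in `U`; reads the v5 engine package's
slack, NOT `(klEngQ6 P R).S′`, so that `klCE6 → klC4aJetC′ → klS6′` has no definitional cycle). -/
def klC4aJetC' (P : SplitConsts) (R : RenConsts) (k : ℕ) : ℝ := 2 ^ 20 * (klEngQ5 P R).S' k

/-- `klC4aJetC 0 = 2^10`. -/
@[simp] theorem klC4aJetC_zero : klC4aJetC 0 = 2 ^ 10 := by simp [klC4aJetC]
/-- `klC4aJetC 1 = 2^10`. -/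
@[simp] theorem klC4aJetC_one : klC4aJetC 1 = 2 ^ 10 := by simp [klC4aJetC]
/-- `klC4aJetC 2 = 1`. -/
@[simp] theorem klC4aJetC_two : klC4aJetC 2 = 1 := by simp [klC4aJetC]
/-- `klC4aJetC 3 = 2^4`. -/
@[simp] theorem klC4aJetC_three : klC4aJetC 3 = 2 ^ 4 := by simp [klC4aJetC]
/-- `klC4aJetC 4 = 2^11`. -/
@[simp] theorem klC4aJetC_four : klC4aJetC 4 = 2 ^ 11 := by simp [klC4aJetC]
/-- `klC4aJetC k = 2^11` for `k ≥ 4`. -/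
theorem klC4aJetC_of_four_le {k : ℕ} (hk : 4 ≤ k) : klC4aJetC k = 2 ^ 11 := by
  unfold klC4aJetC; rw [if_neg (by omega), if_neg (by omega), if_neg (by omega)]
/-- `klC4aJetC' P R k = 2^20·(klEngQ5 P R).S′ k`. -/
theorem klC4aJetC'_eq (P : SplitConsts) (R : RenConsts) (k : ℕ) : klC4aJetC' P R k = 2 ^ 20 * (klEngQ5 P R).S' k := rfl

/-- `0 ≤ klC4aJetC k`. -/
theorem klC4aJetC_nonneg (k : ℕ) : 0 ≤ klC4aJetC k := by
  unfold klC4aJetC; split_ifs <;> positivity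

/-- `1 ≤ klC4aJetC k` (every entry is at least the curvature entry). -/
theorem one_le_klC4aJetC (k : ℕ) : 1 ≤ klC4aJetC k := by
  unfold klC4aJetC; split_ifs <;> norm_num

/-- **`klC4aJetC k ≤ 2^26`** — inside the sufficiency window of `klJetX_mul_le_klS6`. -/
theorem klC4aJetC_le_two_pow (k : ℕ) : klC4aJetC k ≤ 2 ^ 26 := by
  unfold klC4aJetC; split_ifs <;> norm_num

/-- `0 ≤ (klEngQ5 P R).S′ k` (local copy of the tree's `klEngQ5_S'_nonneg`, which lives in a two-leg door module not imported here). -/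
private theorem klEngQ5_S'_nonneg' (P : SplitConsts) (R : RenConsts) (k : ℕ) : 0 ≤ (klEngQ5 P R).S' k := (klEngQ5_wf P R).2.2.2.2.1 k

/-- `0 ≤ klC4aJetC' P R k`. -/
theorem klC4aJetC'_nonneg (P : SplitConsts) (R : RenConsts) (k : ℕ) : 0 ≤ klC4aJetC' P R k := by
  unfold klC4aJetC'; exact mul_nonneg (by positivity) (klEngQ5_S'_nonneg' P R k)

/-- **`klC4aJetC′ P R k ≤ 2^26·(klEngQ5 P R).S′ k`** — inside the sufficiency window of `klJetX_mul_le_klS6'`. -/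
theorem klC4aJetC'_le (P : SplitConsts) (R : RenConsts) (k : ℕ) : klC4aJetC' P R k ≤ 2 ^ 26 * (klEngQ5 P R).S' k := by
  unfold klC4aJetC'
  exact mul_le_mul_of_nonneg_right (by norm_num) (klEngQ5_S'_nonneg' P R k)

/-! ## §2 The package inequalities (what makes the stub (E3a)-feeding through the divided fit) -/

/-- **`klJetX k · klC4aJetC k ≤ klS6 k`.** -/
theorem klJetX_mul_klC4aJetC_le_klS6 (k : ℕ) : klJetX k * klC4aJetC k ≤ klS6 k :=
  klJetX_mul_le_klS6 (klC4aJetC_nonneg k) (klC4aJetC_le_two_pow k) k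

/-- **`klJetX k · klC4aJetC′ P R k ≤ klS6′ P R k`.** -/
theorem klJetX_mul_klC4aJetC'_le_klS6' (P : SplitConsts) (R : RenConsts) (k : ℕ) :
    klJetX k * klC4aJetC' P R k ≤ klS6' P R k :=
  klJetX_mul_le_klS6' (klC4aJetC'_nonneg P R k) k (klC4aJetC'_le P R k)

/-- Divided form against the v6 geometric package: **`klC4aJetC k ≤ klEngGeo6.S k / klJetX k`.** -/
theorem klC4aJetC_le_klEngGeo6_S_div (k : ℕ) : klC4aJetC k ≤ klEngGeo6.S k / klJetX k := by
  rw [le_div_iff₀ (klJetX_pos k), mul_comm]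
  exact (klJetX_mul_klC4aJetC_le_klS6 k).trans (klS6_le_klEngGeo6_S k)

/-- Divided form against the v6 engine package: **`klC4aJetC′ P R k ≤ (klEngQ6 P R).S′ k / klJetX k`.** -/
theorem klC4aJetC'_le_klEngQ6_S'_div (P : SplitConsts) (R : RenConsts) (k : ℕ) :
    klC4aJetC' P R k ≤ (klEngQ6 P R).S' k / klJetX k := by
  rw [le_div_iff₀ (klJetX_pos k), mul_comm]
  exact (klJetX_mul_klC4aJetC'_le_klS6' P R k).trans (klS6'_le_klEngQ6_S' P R k)

/-- The absolute table is below the v6 package's size field: `klC4aJetC k ≤ klEngGeo6.S k`. -/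
theorem klC4aJetC_le_klEngGeo6_S (k : ℕ) : klC4aJetC k ≤ klEngGeo6.S k := by
  have h1 := klJetX_mul_klC4aJetC_le_klS6 k
  have h2 := klS6_le_klEngGeo6_S k
  have hx := one_le_klJetX k
  have hc := klC4aJetC_nonneg k
  nlinarith

/-- The remainder table is below the v6 package's slack field: `klC4aJetC′ P R k ≤ (klEngQ6 P R).S′ k`. -/
theorem klC4aJetC'_le_klEngQ6_S' (P : SplitConsts) (R : RenConsts) (k : ℕ) : klC4aJetC' P R k ≤ (klEngQ6 P R).S' k := by
  have h1 := klJetX_mul_klC4aJetC'_le_klS6' P R k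
  have h2 := klS6'_le_klEngQ6_S' P R k
  have hx := one_le_klJetX k
  have hc := klC4aJetC'_nonneg P R k
  nlinarith

/-! ## §3 The curve-jet bar at C4a's tables vs the package's own `twoLegBar` -/

/-- **`curveJetBar klC4aJetC (klC4aJetC′ P R) U k n ≤ twoLegBar klEngGeo6 (klEngQ6 P R) U k n`** for every `k, n, U`. -/
theorem curveJetBar_klC4aJetC_le_twoLegBar_klEng6 (P : SplitConsts) (R : RenConsts) (U : ℝ) (k n : ℕ) :
    curveJetBar klC4aJetC (klC4aJetC' P R) U k n ≤ twoLegBar klEngGeo6 (klEngQ6 P R) U k n := by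
  rw [← curveJetBar_eq_twoLegBar]
  exact curveJetBar_mono (fun k => klC4aJetC_le_klEngGeo6_S k) (fun k => klC4aJetC'_le_klEngQ6_S' P R k) U k n

section Model

variable {L M : ℕ} [NeZero L] [NeZero M]

/-- **C4a's tables feed the `(G6, Q6)` instance**: `TwoLegCurveJetBound … klC4aJetC (klC4aJetC′ P R) … n → TwoLegCurveJetBoundGQ … klEngGeo6 (klEngQ6 P R) … n`. -/
theorem twoLegCurveJetBoundGQ_klEng6_of_klC4aJetC {P : SplitConsts} {R : RenConsts} {β U μ : ℝ} {K : TrigPolyC4v} {n : ℕ}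
    (h : TwoLegCurveJetBound L M klC4aJetC (klC4aJetC' P R) β U μ K n) :
    TwoLegCurveJetBoundGQ L M klEngGeo6 (klEngQ6 P R) β U μ K n :=
  ⟨h.1, fun k hk θ => (h.2 k hk θ).trans (curveJetBar_klC4aJetC_le_twoLegBar_klEng6 P R U k n)⟩

end Model

end Summit.HubbardSuperconductivity.HubbardSuperconductivity.Theorems.KLRegimeSplit
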